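import Mathlib
import Summits.Ventures.PercRepro2.SwGlue
import Summits.Ventures.PercRepro2.SwSideInj
import Summits.Ventures.PercRepro2.SwGlueB

/-!
# Row (SW) across a cut separating `{l, o}` from `h` (blind cell PercRepro2, night-4 g4, 2026-08-24;
NIGHT4-SIDE.md §5, placement P1)

`l, o` on the first side, `h` on the second.  The nine classes of `Q(G)` are indexed by the status of
the cut vertex `c` in the hull of `l` (first side: `A = c ∈ C_R(l)`, `B = c ∈ C_B(l)`) and in the hull
of `h` (second side: `T = c ∈ C_R(h)`, `T' = c ∈ C_B(h)`), with the compatibilities `¬(A ∧ T)`,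
`¬(B ∧ T')`.  The map `F` (`glueMap`): the second side is swapped except on the class `(R,b)` off the
image of `ψ₁`, where the blue-side permutation `θ₂` (`SwGlueB`) acts; the first side is kept, or
moved by the (SW) permutation `φ₁` of `Q(G₁; l, c, o)` (the hypothesis) on the classes `(N, T)`, by
the (SW-side) injection `ψ₁` (`SwSideInj`) on the class `(B, r)`, and by `ψ₁⁻¹` on the class `(R, b)`
inside the image of `ψ₁`.  `sw_glue_sep_lo`: (SW)(G₁; l, c, o) ⟹ (SW)(G; l, h, o).
-/

namespace Summit.Ventures.PercRepro2

namespace Glue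

open Hull LocRows SwSide

open scoped Classical

variable {V : Type*} {E₁ E₂ : Type*} {ends₁ : E₁ → Sym2 V} {ends₂ : E₂ → Sym2 V} {c : V}
  {V₁ V₂ : Set V}

variable [Fintype E₁] [Fintype E₂] [DecidableEq E₁] [DecidableEq E₂]

section Inverse

variable {E : Type*}

/-- The inverse of an injection on its range (the identity elsewhere). -/
noncomputable def invOn {S : Finset (Config E)} (ψ : {ζ // ζ ∈ S} → Config E) (z : Config E) :
    Config E :=
  if h : ∃ s, ψ s = z then (Classical.choose h).1 else z

/-- `invOn` lands in the domain on the range of `ψ`. -/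
lemma invOn_mem {S : Finset (Config E)} (ψ : {ζ // ζ ∈ S} → Config E) {z : Config E}
    (h : ∃ s, ψ s = z) : invOn ψ z ∈ S := by
  unfold invOn; rw [dif_pos h]; exact (Classical.choose h).2

/-- `invOn` inverts `ψ` on its range. -/
lemma apply_invOn {S : Finset (Config E)} (ψ : {ζ // ζ ∈ S} → Config E) {z : Config E}
    (h : ∃ s, ψ s = z) (hm : invOn ψ z ∈ S) : ψ ⟨invOn ψ z, hm⟩ = z := by
  have e1 : invOn ψ z = (Classical.choose h).1 := by unfold invOn; rw [dif_pos h]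
  have e : (⟨invOn ψ z, hm⟩ : {ζ // ζ ∈ S}) = Classical.choose h := Subtype.ext e1
  rw [e]; exact Classical.choose_spec h

/-- `invOn` is a left inverse of an injection. -/
lemma invOn_apply {S : Finset (Config E)} {ψ : {ζ // ζ ∈ S} → Config E} (hψ : Function.Injective ψ)
    (y : {ζ // ζ ∈ S}) : invOn ψ (ψ y) = y.1 := by
  have h : ∃ s, ψ s = ψ y := ⟨y, rfl⟩
  have e1 : invOn ψ (ψ y) = (Classical.choose h).1 := by unfold invOn; rw [dif_pos h]
  rw [e1]
  have := Classical.choose_spec h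
  exact congrArg Subtype.val (hψ this)

end Inverse

/-- Membership in `Q(G)` for the placement `l, o ∈ V₁`, `h ∈ V₂`. -/
lemma mem_tgtU_sep_lo (hg : IsGluing ends₁ ends₂ c V₁ V₂) {l h o : V} (hl : l ∈ V₁) (ho : o ∈ V₁)
    (hoc : o ≠ c) (hh : h ∈ V₂) (hhc : h ≠ c) (ζ : Config (E₁ ⊕ E₂)) :
    ζ ∈ tgtU (glue ends₁ ends₂) l h {S : Set V | o ∈ S} ↔
      (¬ (c ∈ cluster ends₁ (ζ ∘ Sum.inl) l ∧ c ∈ cluster ends₂ (ζ ∘ Sum.inr) h) ∧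
        ¬ (c ∈ cluster ends₁ (blue (ζ ∘ Sum.inl)) l ∧ c ∈ cluster ends₂ (blue (ζ ∘ Sum.inr)) h)) ∧
        o ∈ cluster ends₁ (ζ ∘ Sum.inl) l ∧ o ∉ cluster ends₁ (blue (ζ ∘ Sum.inl)) l := by
  rw [mem_tgtU_glue_iff, mem_cluster_glue_iff₁ hg hl ho hoc, mem_cluster_glue_iff₁ hg hl ho hoc,
    mem_cluster_glue_iff_across hg hl hh hhc, mem_cluster_glue_iff_across hg hl hh hhc,
    blue_comp_inl, blue_comp_inr]
  have e : ∀ ω : Config E₂, h ∈ cluster ends₂ ω c ↔ c ∈ cluster ends₂ ω h := fun ω =>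
    mem_cluster_comm
  rw [e, e]

omit [Fintype E₁] [Fintype E₂] [DecidableEq E₁] [DecidableEq E₂] in
/-- The red cluster of `h` in the glued graph, for the placement `h ∈ V₂`. -/
lemma cluster_glue_h (hg : IsGluing ends₁ ends₂ c V₁ V₂) {h : V} (hh : h ∈ V₂)
    (ζ : Config (E₁ ⊕ E₂)) :
    cluster (glue ends₁ ends₂) ζ h = cluster ends₂ (ζ ∘ Sum.inr) h ∪
      {x | c ∈ cluster ends₂ (ζ ∘ Sum.inr) h ∧ x ∈ cluster ends₁ (ζ ∘ Sum.inl) c} :=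
  cluster_glue_eq₂ hg hh

/-! ## The map of the nine classes and its decoder -/

section Map

variable (hg : IsGluing ends₁ ends₂ c V₁ V₂) {l h o : V} (hl : l ∈ V₁) (ho : o ∈ V₁) (hoc : o ≠ c)
  (hh : h ∈ V₂) (hhc : h ≠ c)
  (φ : {ζ // ζ ∈ tgtU ends₁ l c {S : Set V | o ∈ S}} → Config E₁)
  (ψ : {ζ // ζ ∈ srcSide ends₁ l c o} → Config E₁)
  (θ : {ζ // ζ ∈ bsideSet ends₂ c h} → Config E₂)

include hg hl ho hoc hh hhc in
/-- The class `(B, ·)` lies in the source of `ψ₁`. -/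
lemma mem_srcSide_of {ζ : Config (E₁ ⊕ E₂)}
    (hζ : ζ ∈ tgtU (glue ends₁ ends₂) l h {S : Set V | o ∈ S})
    (hA : c ∉ cluster ends₁ (ζ ∘ Sum.inl) l) (hB : c ∈ cluster ends₁ (blue (ζ ∘ Sum.inl)) l) :
    ζ ∘ Sum.inl ∈ srcSide ends₁ l c o := by
  obtain ⟨_, ho1, ho2⟩ := (mem_tgtU_sep_lo hg hl ho hoc hh hhc ζ).1 hζ
  simp only [srcSide, Finset.mem_filter, Finset.mem_univ, true_and, mem_rside_iff, mem_bside_iff]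
  exact ⟨⟨ho1, ho2⟩, hB, hA⟩

include hg hl ho hoc hh hhc in
/-- The class `(N, ·)` lies in `Q(G₁; l, c, o)`. -/
lemma mem_tgtU₁_of {ζ : Config (E₁ ⊕ E₂)}
    (hζ : ζ ∈ tgtU (glue ends₁ ends₂) l h {S : Set V | o ∈ S})
    (hA : c ∉ cluster ends₁ (ζ ∘ Sum.inl) l) (hB : c ∉ cluster ends₁ (blue (ζ ∘ Sum.inl)) l) :
    ζ ∘ Sum.inl ∈ tgtU ends₁ l c {S : Set V | o ∈ S} := by
  obtain ⟨_, ho1, ho2⟩ := (mem_tgtU_sep_lo hg hl ho hoc hh hhc ζ).1 hζ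
  simp only [tgtU, Finset.mem_filter, Finset.mem_univ, true_and, mem_hull_iff, Set.mem_setOf_eq,
    not_or]
  exact ⟨⟨hA, hB⟩, ho1, ho2⟩

include hg hl ho hoc hh hhc in
/-- The class `(R, b)` lies on the blue side of `h` on the second side. -/
lemma mem_bsideSet_of {ζ : Config (E₁ ⊕ E₂)}
    (hζ : ζ ∈ tgtU (glue ends₁ ends₂) l h {S : Set V | o ∈ S})
    (hA : c ∈ cluster ends₁ (ζ ∘ Sum.inl) l) (hT' : c ∈ cluster ends₂ (blue (ζ ∘ Sum.inr)) h) :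
    ζ ∘ Sum.inr ∈ bsideSet ends₂ c h := by
  obtain ⟨⟨h1, _⟩, _⟩ := (mem_tgtU_sep_lo hg hl ho hoc hh hhc ζ).1 hζ
  simp only [bsideSet, Finset.mem_filter, Finset.mem_univ, true_and]
  exact ⟨hT', fun hT => h1 ⟨hA, hT⟩⟩

/-- **The map of the nine classes.**  Second side swapped, except on `(R, b)` off the image of `ψ`
(there: `θ`); first side kept, except `φ` on `(N, T)`, `ψ` on `(B, r)`, `ψ⁻¹` on `(R, b)` in the image
of `ψ`. -/
noncomputable def glueMap (x : {ζ // ζ ∈ tgtU (glue ends₁ ends₂) l h {S : Set V | o ∈ S}}) :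
    Config (E₁ ⊕ E₂) :=
  if hA : c ∈ cluster ends₁ (x.1 ∘ Sum.inl) l then
    if c ∈ cluster ends₁ (blue (x.1 ∘ Sum.inl)) l then swap₂ x.1
    else if hT' : c ∈ cluster ends₂ (blue (x.1 ∘ Sum.inr)) h then
      if ∃ s, ψ s = x.1 ∘ Sum.inl then pair (invOn ψ (x.1 ∘ Sum.inl)) (blue (x.1 ∘ Sum.inr))
      else pair (x.1 ∘ Sum.inl) (θ ⟨x.1 ∘ Sum.inr, mem_bsideSet_of hg hl ho hoc hh hhc x.2 hA hT'⟩)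
    else swap₂ x.1
  else if hB : c ∈ cluster ends₁ (blue (x.1 ∘ Sum.inl)) l then
    if c ∈ cluster ends₂ (x.1 ∘ Sum.inr) h then
      pair (ψ ⟨x.1 ∘ Sum.inl, mem_srcSide_of hg hl ho hoc hh hhc x.2 hA hB⟩) (blue (x.1 ∘ Sum.inr))
    else swap₂ x.1
  else if c ∈ cluster ends₂ (x.1 ∘ Sum.inr) h then
    pair (φ ⟨x.1 ∘ Sum.inl, mem_tgtU₁_of hg hl ho hoc hh hhc x.2 hA hB⟩) (blue (x.1 ∘ Sum.inr))
  else swap₂ x.1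

/-- **The decoder**: recovers the source from the image by the statuses of the image. -/
noncomputable def glueDec (z : Config (E₁ ⊕ E₂)) : Config (E₁ ⊕ E₂) :=
  if c ∈ cluster ends₁ (z ∘ Sum.inl) l then
    if c ∈ cluster ends₁ (blue (z ∘ Sum.inl)) l then swap₂ z
    else if c ∈ cluster ends₂ (blue (z ∘ Sum.inr)) h then
      if ∃ s, ψ s = z ∘ Sum.inl then pair (invOn ψ (z ∘ Sum.inl)) (blue (z ∘ Sum.inr))
      else pair (z ∘ Sum.inl) (invOn θ (z ∘ Sum.inr))
    else swap₂ z
  else if c ∈ cluster ends₁ (blue (z ∘ Sum.inl)) l then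
    if c ∈ cluster ends₂ (z ∘ Sum.inr) h then
      if hs : z ∘ Sum.inl ∈ srcSide ends₁ l c o then pair (ψ ⟨z ∘ Sum.inl, hs⟩) (blue (z ∘ Sum.inr))
      else z
    else swap₂ z
  else if c ∈ cluster ends₂ (blue (z ∘ Sum.inr)) h then
    pair (invOn φ (z ∘ Sum.inl)) (blue (z ∘ Sum.inr))
  else swap₂ z


/-! ### Evaluation of the map on the eight leaves -/

variable {hg hl ho hoc hh hhc φ ψ θ}
variable (x : {ζ // ζ ∈ tgtU (glue ends₁ ends₂) l h {S : Set V | o ∈ S}})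

/-- The map on the class `(K, n)`: the second side is swapped. -/
lemma glueMap_KN (hA : c ∈ cluster ends₁ (x.1 ∘ Sum.inl) l)
    (hB : c ∈ cluster ends₁ (blue (x.1 ∘ Sum.inl)) l) :
    glueMap hg hl ho hoc hh hhc φ ψ θ x = swap₂ x.1 := by
  unfold glueMap; rw [dif_pos hA, if_pos hB]

/-- The map on the class `(R, b)` inside the image of `ψ`: `ψ⁻¹` on the first side, the swap on the second. -/
lemma glueMap_RB_in (hA : c ∈ cluster ends₁ (x.1 ∘ Sum.inl) l)
    (hB : c ∉ cluster ends₁ (blue (x.1 ∘ Sum.inl)) l)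
    (hT' : c ∈ cluster ends₂ (blue (x.1 ∘ Sum.inr)) h) (hr : ∃ s, ψ s = x.1 ∘ Sum.inl) :
    glueMap hg hl ho hoc hh hhc φ ψ θ x = pair (invOn ψ (x.1 ∘ Sum.inl)) (blue (x.1 ∘ Sum.inr)) := by
  unfold glueMap; rw [dif_pos hA, if_neg hB, dif_pos hT', if_pos hr]

/-- The map on the class `(R, b)` off the image of `ψ`: the first side is kept, `θ` acts on the second. -/
lemma glueMap_RB_out (hA : c ∈ cluster ends₁ (x.1 ∘ Sum.inl) l)
    (hB : c ∉ cluster ends₁ (blue (x.1 ∘ Sum.inl)) l)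
    (hT' : c ∈ cluster ends₂ (blue (x.1 ∘ Sum.inr)) h) (hr : ¬ ∃ s, ψ s = x.1 ∘ Sum.inl) :
    glueMap hg hl ho hoc hh hhc φ ψ θ x =
      pair (x.1 ∘ Sum.inl) (θ ⟨x.1 ∘ Sum.inr, mem_bsideSet_of hg hl ho hoc hh hhc x.2 hA hT'⟩) := by
  unfold glueMap; rw [dif_pos hA, if_neg hB, dif_pos hT', if_neg hr]

/-- The map on the class `(R, n)`: the second side is swapped. -/
lemma glueMap_RN (hA : c ∈ cluster ends₁ (x.1 ∘ Sum.inl) l)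
    (hB : c ∉ cluster ends₁ (blue (x.1 ∘ Sum.inl)) l)
    (hT' : c ∉ cluster ends₂ (blue (x.1 ∘ Sum.inr)) h) :
    glueMap hg hl ho hoc hh hhc φ ψ θ x = swap₂ x.1 := by
  unfold glueMap; rw [dif_pos hA, if_neg hB, dif_neg hT']

/-- The map on the class `(B, r)`: `ψ` on the first side, the swap on the second. -/
lemma glueMap_BR (hA : c ∉ cluster ends₁ (x.1 ∘ Sum.inl) l)
    (hB : c ∈ cluster ends₁ (blue (x.1 ∘ Sum.inl)) l) (hT : c ∈ cluster ends₂ (x.1 ∘ Sum.inr) h) :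
    glueMap hg hl ho hoc hh hhc φ ψ θ x =
      pair (ψ ⟨x.1 ∘ Sum.inl, mem_srcSide_of hg hl ho hoc hh hhc x.2 hA hB⟩) (blue (x.1 ∘ Sum.inr)) := by
  unfold glueMap; rw [dif_neg hA, dif_pos hB, if_pos hT]

/-- The map on the class `(B, n)`: the second side is swapped. -/
lemma glueMap_BN (hA : c ∉ cluster ends₁ (x.1 ∘ Sum.inl) l)
    (hB : c ∈ cluster ends₁ (blue (x.1 ∘ Sum.inl)) l) (hT : c ∉ cluster ends₂ (x.1 ∘ Sum.inr) h) :
    glueMap hg hl ho hoc hh hhc φ ψ θ x = swap₂ x.1 := by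
  unfold glueMap; rw [dif_neg hA, dif_pos hB, if_neg hT]

/-- The map on the classes `(N, T)`: `φ` on the first side, the swap on the second. -/
lemma glueMap_NT (hA : c ∉ cluster ends₁ (x.1 ∘ Sum.inl) l)
    (hB : c ∉ cluster ends₁ (blue (x.1 ∘ Sum.inl)) l) (hT : c ∈ cluster ends₂ (x.1 ∘ Sum.inr) h) :
    glueMap hg hl ho hoc hh hhc φ ψ θ x =
      pair (φ ⟨x.1 ∘ Sum.inl, mem_tgtU₁_of hg hl ho hoc hh hhc x.2 hA hB⟩) (blue (x.1 ∘ Sum.inr)) := by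
  unfold glueMap; rw [dif_neg hA, dif_neg hB, if_pos hT]

/-- The map on the classes `(N, ¬T)`: the second side is swapped. -/
lemma glueMap_NN (hA : c ∉ cluster ends₁ (x.1 ∘ Sum.inl) l)
    (hB : c ∉ cluster ends₁ (blue (x.1 ∘ Sum.inl)) l) (hT : c ∉ cluster ends₂ (x.1 ∘ Sum.inr) h) :
    glueMap hg hl ho hoc hh hhc φ ψ θ x = swap₂ x.1 := by
  unfold glueMap; rw [dif_neg hA, dif_neg hB, if_neg hT]

/-! ### Evaluation of the decoder -/

variable (z : Config (E₁ ⊕ E₂))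

/-- The decoder on the class `(K, n)`. -/
lemma glueDec_KN (hA : c ∈ cluster ends₁ (z ∘ Sum.inl) l) (hB : c ∈ cluster ends₁ (blue (z ∘ Sum.inl)) l) :
    glueDec (l := l) (h := h) (o := o) φ ψ θ z = swap₂ z := by
  unfold glueDec; rw [if_pos hA, if_pos hB]

/-- The decoder on the class `(R, b)` inside the image of `ψ`. -/
lemma glueDec_RB_in (hA : c ∈ cluster ends₁ (z ∘ Sum.inl) l)
    (hB : c ∉ cluster ends₁ (blue (z ∘ Sum.inl)) l) (hT' : c ∈ cluster ends₂ (blue (z ∘ Sum.inr)) h)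
    (hr : ∃ s, ψ s = z ∘ Sum.inl) :
    glueDec (l := l) (h := h) (o := o) φ ψ θ z = pair (invOn ψ (z ∘ Sum.inl)) (blue (z ∘ Sum.inr)) := by
  unfold glueDec; rw [if_pos hA, if_neg hB, if_pos hT', if_pos hr]

/-- The decoder on the class `(R, b)` off the image of `ψ`. -/
lemma glueDec_RB_out (hA : c ∈ cluster ends₁ (z ∘ Sum.inl) l)
    (hB : c ∉ cluster ends₁ (blue (z ∘ Sum.inl)) l) (hT' : c ∈ cluster ends₂ (blue (z ∘ Sum.inr)) h)
    (hr : ¬ ∃ s, ψ s = z ∘ Sum.inl) :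
    glueDec (l := l) (h := h) (o := o) φ ψ θ z = pair (z ∘ Sum.inl) (invOn θ (z ∘ Sum.inr)) := by
  unfold glueDec; rw [if_pos hA, if_neg hB, if_pos hT', if_neg hr]

/-- The decoder on the class `(R, n)`. -/
lemma glueDec_RN (hA : c ∈ cluster ends₁ (z ∘ Sum.inl) l)
    (hB : c ∉ cluster ends₁ (blue (z ∘ Sum.inl)) l) (hT' : c ∉ cluster ends₂ (blue (z ∘ Sum.inr)) h) :
    glueDec (l := l) (h := h) (o := o) φ ψ θ z = swap₂ z := by
  unfold glueDec; rw [if_pos hA, if_neg hB, if_neg hT']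

/-- The decoder on the class `(B, r)`. -/
lemma glueDec_BR (hA : c ∉ cluster ends₁ (z ∘ Sum.inl) l)
    (hB : c ∈ cluster ends₁ (blue (z ∘ Sum.inl)) l) (hT : c ∈ cluster ends₂ (z ∘ Sum.inr) h)
    (hs : z ∘ Sum.inl ∈ srcSide ends₁ l c o) :
    glueDec (l := l) (h := h) (o := o) φ ψ θ z = pair (ψ ⟨z ∘ Sum.inl, hs⟩) (blue (z ∘ Sum.inr)) := by
  unfold glueDec; rw [if_neg hA, if_pos hB, if_pos hT, dif_pos hs]

/-- The decoder on the class `(B, n)`. -/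
lemma glueDec_BN (hA : c ∉ cluster ends₁ (z ∘ Sum.inl) l)
    (hB : c ∈ cluster ends₁ (blue (z ∘ Sum.inl)) l) (hT : c ∉ cluster ends₂ (z ∘ Sum.inr) h) :
    glueDec (l := l) (h := h) (o := o) φ ψ θ z = swap₂ z := by
  unfold glueDec; rw [if_neg hA, if_pos hB, if_neg hT]

/-- The decoder on the classes `(N, T')`. -/
lemma glueDec_NT (hA : c ∉ cluster ends₁ (z ∘ Sum.inl) l)
    (hB : c ∉ cluster ends₁ (blue (z ∘ Sum.inl)) l) (hT' : c ∈ cluster ends₂ (blue (z ∘ Sum.inr)) h) :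
    glueDec (l := l) (h := h) (o := o) φ ψ θ z = pair (invOn φ (z ∘ Sum.inl)) (blue (z ∘ Sum.inr)) := by
  unfold glueDec; rw [if_neg hA, if_neg hB, if_pos hT']

/-- The decoder on the classes `(N, ¬T')`. -/
lemma glueDec_NN (hA : c ∉ cluster ends₁ (z ∘ Sum.inl) l)
    (hB : c ∉ cluster ends₁ (blue (z ∘ Sum.inl)) l) (hT' : c ∉ cluster ends₂ (blue (z ∘ Sum.inr)) h) :
    glueDec (l := l) (h := h) (o := o) φ ψ θ z = swap₂ z := by
  unfold glueDec; rw [if_neg hA, if_neg hB, if_neg hT']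


/-! ### The decoder inverts the map -/

/-- Unpacking membership in `srcSide`. -/
lemma status_of_mem_srcSide {w : Config E₁} (hw : w ∈ srcSide ends₁ l c o) :
    c ∉ cluster ends₁ w l ∧ c ∈ cluster ends₁ (blue w) l := by
  simp only [srcSide, Finset.mem_filter, Finset.mem_univ, true_and, mem_bside_iff] at hw
  exact ⟨hw.2.2, hw.2.1⟩

/-- Unpacking membership in `tgtSide`. -/
lemma status_of_mem_tgtSide {w : Config E₁} (hw : w ∈ tgtSide ends₁ l c o) :
    c ∈ cluster ends₁ w l ∧ c ∉ cluster ends₁ (blue w) l := by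
  simp only [tgtSide, Finset.mem_filter, Finset.mem_univ, true_and, mem_rside_iff] at hw
  exact ⟨hw.2.1, hw.2.2⟩

/-- Unpacking membership in `Q(G₁; l, c, o)`. -/
lemma status_of_mem_tgtU₁ {w : Config E₁} (hw : w ∈ tgtU ends₁ l c {S : Set V | o ∈ S}) :
    c ∉ cluster ends₁ w l ∧ c ∉ cluster ends₁ (blue w) l := by
  simp only [tgtU, Finset.mem_filter, Finset.mem_univ, true_and, mem_hull_iff, not_or] at hw
  exact hw.1

/-- Unpacking membership in `bsideSet`. -/
lemma status_of_mem_bsideSet {w : Config E₂} (hw : w ∈ bsideSet ends₂ c h) :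
    c ∈ cluster ends₂ (blue w) h ∧ c ∉ cluster ends₂ w h := by
  simpa only [bsideSet, Finset.mem_filter, Finset.mem_univ, true_and] using hw

/-- **The decoder inverts the map on `Q(G)`.** -/
theorem glueDec_glueMap (hφ : Function.Injective φ)
    (hmemφ : ∀ y, φ y ∈ tgtU ends₁ l c {S : Set V | o ∈ S}) (hψ : Function.Injective ψ)
    (hmemψ : ∀ y, ψ y ∈ tgtSide ends₁ l c o) (hθ : Function.Injective θ)
    (hmemθ : ∀ y, θ y ∈ bsideSet ends₂ c h) :
    glueDec (l := l) (h := h) (o := o) φ ψ θ (glueMap hg hl ho hoc hh hhc φ ψ θ x) = x.1 := by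
  obtain ⟨⟨hc1, hc2⟩, _, _⟩ := (mem_tgtU_sep_lo hg hl ho hoc hh hhc x.1).1 x.2
  by_cases hA : c ∈ cluster ends₁ (x.1 ∘ Sum.inl) l
  · by_cases hB : c ∈ cluster ends₁ (blue (x.1 ∘ Sum.inl)) l
    · -- (K, n)
      rw [glueMap_KN x hA hB, glueDec_KN _ (by rw [swap₂_inl]; exact hA)
        (by rw [swap₂_inl]; exact hB), swap₂_swap₂]
    · by_cases hT' : c ∈ cluster ends₂ (blue (x.1 ∘ Sum.inr)) h
      · by_cases hr : ∃ s, ψ s = x.1 ∘ Sum.inl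
        · -- (R, b) inside the image of `ψ`
          rw [glueMap_RB_in x hA hB hT' hr]
          have hw := invOn_mem ψ hr
          obtain ⟨hwA, hwB⟩ := status_of_mem_srcSide hw
          rw [glueDec_BR _ (by rw [pair_inl]; exact hwA) (by rw [pair_inl]; exact hwB)
            (by rw [pair_inr]; exact hT') (by rw [pair_inl]; exact hw)]
          rw [pair_inr, blue_blue]
          have e : (⟨pair (invOn ψ (x.1 ∘ Sum.inl)) (blue (x.1 ∘ Sum.inr)) ∘ Sum.inl, by
              rw [pair_inl]; exact hw⟩ : {ζ // ζ ∈ srcSide ends₁ l c o}) =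
              ⟨invOn ψ (x.1 ∘ Sum.inl), hw⟩ :=
            Subtype.ext (pair_inl (invOn ψ (x.1 ∘ Sum.inl)) (blue (x.1 ∘ Sum.inr)))
          rw [e, apply_invOn ψ hr hw, pair_comp]
        · -- (R, b) off the image of `ψ`
          rw [glueMap_RB_out x hA hB hT' hr]
          obtain ⟨hθ1, _⟩ := status_of_mem_bsideSet (hmemθ ⟨x.1 ∘ Sum.inr,
            mem_bsideSet_of hg hl ho hoc hh hhc x.2 hA hT'⟩)
          rw [glueDec_RB_out _ (by rw [pair_inl]; exact hA) (by rw [pair_inl]; exact hB)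
            (by rw [pair_inr]; exact hθ1) (by rw [pair_inl]; exact hr)]
          rw [pair_inl, pair_inr, invOn_apply hθ, pair_comp]
      · -- (R, n)
        have hT : c ∉ cluster ends₂ (x.1 ∘ Sum.inr) h := fun hT => hc1 ⟨hA, hT⟩
        rw [glueMap_RN x hA hB hT', glueDec_RN _ (by rw [swap₂_inl]; exact hA)
          (by rw [swap₂_inl]; exact hB) (by rw [swap₂_inr, blue_blue]; exact hT), swap₂_swap₂]
  · by_cases hB : c ∈ cluster ends₁ (blue (x.1 ∘ Sum.inl)) l
    · by_cases hT : c ∈ cluster ends₂ (x.1 ∘ Sum.inr) h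
      · -- (B, r)
        rw [glueMap_BR x hA hB hT]
        obtain ⟨hwA, hwB⟩ := status_of_mem_tgtSide (hmemψ ⟨x.1 ∘ Sum.inl,
          mem_srcSide_of hg hl ho hoc hh hhc x.2 hA hB⟩)
        rw [glueDec_RB_in _ (by rw [pair_inl]; exact hwA) (by rw [pair_inl]; exact hwB)
          (by rw [pair_inr, blue_blue]; exact hT) (by rw [pair_inl]; exact ⟨_, rfl⟩)]
        rw [pair_inl, pair_inr, blue_blue, invOn_apply hψ, pair_comp]
      · -- (B, n)
        have hT' : c ∉ cluster ends₂ (blue (x.1 ∘ Sum.inr)) h := fun hT' => hc2 ⟨hB, hT'⟩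
        rw [glueMap_BN x hA hB hT, glueDec_BN _ (by rw [swap₂_inl]; exact hA)
          (by rw [swap₂_inl]; exact hB) (by rw [swap₂_inr]; exact hT'), swap₂_swap₂]
    · by_cases hT : c ∈ cluster ends₂ (x.1 ∘ Sum.inr) h
      · -- (N, T)
        rw [glueMap_NT x hA hB hT]
        obtain ⟨hwA, hwB⟩ := status_of_mem_tgtU₁ (hmemφ ⟨x.1 ∘ Sum.inl,
          mem_tgtU₁_of hg hl ho hoc hh hhc x.2 hA hB⟩)
        rw [glueDec_NT _ (by rw [pair_inl]; exact hwA) (by rw [pair_inl]; exact hwB)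
          (by rw [pair_inr, blue_blue]; exact hT)]
        rw [pair_inl, pair_inr, blue_blue, invOn_apply hφ, pair_comp]
      · -- (N, ¬T)
        rw [glueMap_NN x hA hB hT, glueDec_NN _ (by rw [swap₂_inl]; exact hA)
          (by rw [swap₂_inl]; exact hB) (by rw [swap₂_inr, blue_blue]; exact hT), swap₂_swap₂]

end Map

end Glue

end Summit.Ventures.PercRepro2
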